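import Summits.BirchSwinnertonDyer.BirchSwinnertonDyer.Theorems.AdditiveBranchIMCGordTwoTwistedLogLevel
import Summits.BirchSwinnertonDyer.BirchSwinnertonDyer.Theorems.AdditiveBranchIMCGordTwoTwistedWanDefs
import Summits.BirchSwinnertonDyer.BirchSwinnertonDyer.Theorems.SchneiderFreeAdditiveX3KYReadEmbAtCompat
import Summits.BirchSwinnertonDyer.BirchSwinnertonDyer.Theorems.SchneiderFreeAdditiveX3BranchIMCRebaseHeight
import Summits.BirchSwinnertonDyer.Rank1Residual.ManinAdditive.TwistOrbitManinNearInvariance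
import Summits.BirchSwinnertonDyer.Rank1Residual.X11b.BDPRouteLocalIndexTransport
import Summits.BirchSwinnertonDyer.BirchSwinnertonDyer.Theorems.AdditiveBranchIMCGordTwoTwistedLooseDefs
import Summits.BirchSwinnertonDyer.BirchSwinnertonDyer.Theorems.AdditiveBranchIMCGordTwoTwistedLogTransport
import HarnessLib
import HarnessLib.Audit.Tags

/-!
# LOOSE VARIANT (LEAD g18, door C «loose SU prime» of LeadReport26 §4 / LeadReport27 §4.2; crux 19357 `three_field_road` and the pen's r₁ twin 19358):
# the logarithm transport `logTransport_twisted` of `AdditiveBranchIMCGordTwoTwistedLogTransport.lean` (LEAD g16, p810808) VERBATIM with the field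
# hypothesis `TameRoadFieldTwisted W p q K` REPLACED by `TameRoadFieldTwistedLoose W p q K` (`AdditiveBranchIMCGordTwoTwistedLooseDefs.lean`, p816632:
# the twisted Wan prime WITHOUT Skinner–Urban's clause `p ∤ v_q(j)`; the transport only reads `K` imaginary quadratic, `p` split, `q ≠ p`).
# Theorems only (no definition, no named fact, no `sorry`); `--supports` 19357, helper only; 19357 / 19358 stay OPEN; BSD is proved for no curve.
#
# * `logTransport_twisted_loose`.
-/

noncomputable section

open scoped Classical NNReal

open WeierstrassCurve NumberField IsDedekindDomain Field
  Literature.NumberTheory.EllipticCurves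
  Literature.NumberTheory.EllipticCurves.FormalGroupChart
  Literature.NumberTheory.EllipticCurves.LiuZhangZhang2018
  Summit.BirchSwinnertonDyer.Rank1Residual
  Summit.BirchSwinnertonDyer.Rank1Residual.X11b
  Summit.BirchSwinnertonDyer.Rank1Residual.X11b.Halves
  Summit.BirchSwinnertonDyer.BirchSwinnertonDyer.Theorems.SchneiderFree
  Summit.BirchSwinnertonDyer.BirchSwinnertonDyer.Theorems.SchneiderFree.KYRead.LogDescent

set_option linter.dupNamespace false
set_option autoImplicit false

namespace Summit.BirchSwinnertonDyer.BirchSwinnertonDyer.Theorems.TwistedWanRoad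

/-! ## §1 The twist descent of the logarithm, with `‖Δ_W‖ = ‖Δ_{W′}‖` in place of `p ∤ Δ_{W′}` -/


section Transport

/-- ★ **THE LOGARITHM TRANSPORT ON THE TWISTED ROAD** — the statement `LogTransportTwistedR0` of the skeleton v41 of crux
`GordTwoRankZeroOffCaseOne` (line `three_field_road`), i.e. its registered kernel stub `stub_logTransportTwistedR0`, PROVED. For a
twisted road field `K` at `q` (`TameRoadFieldTwisted W p q K`: `K` imaginary quadratic, `p` split, `q ≠ p` odd), `p ≠ 2`, the globally
minimal `W₁` with `C • E^{(q*)} = W₁`, an infinite place `w₀`, ANY `y ∈ W₁(H_K)` (`H_K = ringClassField K w₀.embedding 1`), a square root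
`θ ∈ H_K` of `q*` with sign cocycle `s` and the character `ν = s` of `Gal(H_K/K)`: the Galois descent `Q ∈ E(K)` of `Φ(Σ_τ s(τ)τy)`
along the twist isomorphism `Φ = (C₂)_* ∘ ι_θ⁻¹ ∘ D_*` (presentation `E = C₂ • ((D • W₁) ⊗ χ_{q*})`, `exists_charNeTwoNF_presentation`;
descent and height clause `[H_K:K]⁻¹ ĥ(Σ s(τ)τy) = ĥ(Q)` by `SchneiderFree.exists_descent_twistedHeegner`) satisfies, for every datum
`ι′ : ℚ̄_p ≃ ℂ` and degree-one `𝔭′ ∋ p` induced by `ι′`: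
`heegnerCharLogSum ι′ w₀.embedding 1 W₁ ν y = λ · log_{ω_E}(Q)_{embAt K p 𝔭′}` with `‖λ‖ = 1`. Proof: the weighted sum is
`log_{ω_{W₁}}` of the twisted trace read in `ℂ_p` (`heegnerCharLogSum_eq_padicLog_map_sum`: every `H_K`-point has a multiple in the
level); the twist descent of the logarithm (§1) with `‖Δ_E‖_p = ‖Δ_{W₁}‖_p` (§2: `q*` is a `p`-unit, `p` odd); and
`ι′⁻¹ ∘ w₀.embedding = embAt K p 𝔭′` on `K` (door cell's `symm_apply_eq_embAt_of_forall_mem_iff_norm_lt_one`, the conjugate prime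
`𝔭̄′ ≠ 𝔭′` existing as `p` splits). [cite: SilvermanAEC2009, III.1 Table 3.1, Thm. IV.6.4 with Prop. VII.2.2, X.5 Cor. 5.4]
[cite: CastellaHsieh2018, §3.3 (arXiv:1505.08165 p. 9)] [cite: LiuZhangZhang2018, (1.5) (Duke 167 pp. 746–747)] -/
theorem logTransport_twisted_loose :
    ∀ (W : WeierstrassCurve ℚ) [W.IsElliptic] [W.IsGloballyMinimal] (p : ℕ) [Fact p.Prime] (q : ℕ) [Fact q.Prime]
    (K : Type) [Field K] [NumberField K], TameRoadFieldTwistedLoose W p q K → p ≠ 2 →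
    ∀ (W₁ : WeierstrassCurve ℚ) [W₁.IsElliptic] [W₁.IsGloballyMinimal]
    [(W₁.baseChange ℂ_[p]).IsIntegral (NormedField.valuation (K := ℂ_[p])).integer]
    (C : VariableChange ℚ), C • W.quadraticTwist (((-1 : ℤ) ^ (q / 2) * q : ℤ) : ℚ) = W₁ →
    ∀ (w₀ : InfinitePlace K) [NumberField (ringClassField K w₀.embedding 1)]
    (y : (W₁.baseChange (ringClassField K w₀.embedding 1)).toAffine.Point)
    (θ : ringClassField K w₀.embedding 1),
    θ ^ 2 = ((((-1 : ℤ) ^ (q / 2) * q : ℤ)) : ringClassField K w₀.embedding 1) → θ ≠ 0 →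
    ∀ (s : ringClassGal w₀.embedding 1 → ℤˣ),
    (∀ σ : ringClassGal w₀.embedding 1, σ.1 θ = ((s σ : ℤ) : ringClassField K w₀.embedding 1) * θ) →
    ∀ (ν : ringClassGal w₀.embedding 1 →* ℂˣ), (∀ σ, ((ν σ : ℂˣ) : ℂ) = ((s σ : ℤ) : ℂ)) →
    ∃ Q : (W.baseChange K).toAffine.Point,
      ((Module.finrank K (ringClassField K w₀.embedding 1) : ℝ))⁻¹ *
          (∑ τ : ringClassGal w₀.embedding 1,
            (s τ : ℤ) • pointGalHom W₁ (ringClassField K w₀.embedding 1 : Type) τ.1 y).canonicalHeight =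
        Q.canonicalHeight ∧
      ∀ (ι' : PadicAlgCl p ≃+* ℂ) (𝔭' : HeightOneSpectrum (𝓞 K)) (h𝔭' : ((p : ℕ) : 𝓞 K) ∈ 𝔭'.asIdeal)
        (he' : 𝔭'.asIdeal.ramificationIdx (𝓞 ℚ) = 1) (hf' : 𝔭'.asIdeal.inertiaDeg (𝓞 ℚ) = 1),
        (∀ (w : InfinitePlace K) (k : 𝓞 K), k ∈ 𝔭'.asIdeal ↔ ‖ι'.symm (w.embedding (k : K))‖ < 1) →
        ∃ lam : ℂ_[p], ‖lam‖ = 1 ∧ heegnerCharLogSum ι' w₀.embedding 1 W₁ ν y =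
          lam * algebraMap ℚ_[p] ℂ_[p] (logOmega W p (embAt K p 𝔭' h𝔭' he' hf') Q) := by
  intro W _ _ p _ q _ K _ _ hK hp2 W₁ _ _ _ C hC w₀ _ y θ hθ2 hθ0 s hθσ ν hν
  have hp : p.Prime := Fact.out
  have hq : q.Prime := Fact.out
  obtain ⟨hKiq, -, ⟨hqp, -, -, -⟩, -, -, -, hHp⟩ := hK
  have h2f : Module.finrank ℚ K = 2 := hKiq.1
  have hsplit : SplitsIn K p := hHp p hp (dvd_refl p)
  -- the twist parameter `q* = (-1)^{(q-1)/2} q`, a `p`-unit (no `set`: abstraction over `ℂ_p`-terms is too expensive)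
  have hd₁0 : ((-1 : ℤ) ^ (q / 2) * q : ℤ) ≠ 0 :=
    mul_ne_zero (pow_ne_zero _ (by norm_num)) (by exact_mod_cast hq.ne_zero)
  have hdQ : (((-1 : ℤ) ^ (q / 2) * q : ℤ) : ℚ) ≠ 0 := by exact_mod_cast hd₁0
  have hpd : ¬ (p : ℤ) ∣ ((-1 : ℤ) ^ (q / 2) * q : ℤ) := by
    intro h
    have h' : (p : ℤ) ∣ (q : ℤ) := ((isUnit_neg_one (α := ℤ)).pow (q / 2)).dvd_mul_left.mp h
    exact hqp ((Nat.prime_dvd_prime_iff_eq hp hq).mp (Int.natCast_dvd_natCast.mp h')).symm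
  -- the reverse presentation `E = C₂ • ((D • W₁) ⊗ χ_{q*})`, `D • W₁` in `a₁ = a₃ = 0` form
  obtain ⟨C', hC'⟩ := SchneiderFree.exists_smul_quadraticTwist_eq_of_smul_quadraticTwist_eq W W₁ hdQ C hC
  haveI hNF : ((@WeierstrassCurve.toCharNeTwoNF ℚ _ W₁ (invertibleOfNonzero two_ne_zero)) • W₁).IsCharNeTwoNF :=
    @WeierstrassCurve.toCharNeTwoNF_spec ℚ _ W₁ (invertibleOfNonzero two_ne_zero)
  obtain ⟨C₂, hC₂⟩ := SchneiderFree.exists_charNeTwoNF_presentation W₁ W _ C' hC'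
  generalize hDdef : @WeierstrassCurve.toCharNeTwoNF ℚ _ W₁ (invertibleOfNonzero two_ne_zero) = D at hNF hC₂
  subst hC₂
  -- the descended point with its height clause
  have hθ2' : θ ^ 2 = algebraMap ℚ (ringClassField K w₀.embedding 1) (((-1 : ℤ) ^ (q / 2) * q : ℤ) : ℚ) := by
    rw [hθ2, map_intCast]
  obtain ⟨Q, hQ, hheight, -⟩ := SchneiderFree.exists_descent_twistedHeegner w₀.embedding 1 hKiq one_ne_zero W₁ D C₂
    hθ2' hθ0 ν s hν hθσ hdQ y
  refine ⟨Q, hheight, fun ι' 𝔭' h𝔭' he' hf' hcompat ↦ ?_⟩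
  -- the two `p`-adic embeddings of `K` agree: `ι′⁻¹ ∘ w₀.embedding = embAt K p 𝔭′`
  obtain ⟨-, 𝔮, -, hne, h𝔮, -⟩ := LocalIndexTransport.exists_conj_prime_of_splitsIn K p h2f hsplit h𝔭'
  obtain ⟨he𝔮, hf𝔮⟩ := degreeOne_of_splitsIn h2f hsplit h𝔮
  have hind : ∀ k : 𝓞 K, k ∈ 𝔭'.asIdeal ↔ ‖ι'.symm (w₀.embedding (k : K))‖ < 1 := fun k ↦ hcompat w₀ k
  have heC : ∀ x, ‖(algebraMap ℚ_[p] ℂ_[p] : ℚ_[p] →+* ℂ_[p]) x‖ = ‖x‖ := fun x ↦ norm_algebraMap' ℂ_[p] x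
  have hj : ∀ x : K, ringClassFieldToPadicComplex (p := p) ι' w₀.embedding 1
        (algebraMap K (ringClassField K w₀.embedding 1) x) =
      (algebraMap ℚ_[p] ℂ_[p] : ℚ_[p] →+* ℂ_[p]) (embAt K p 𝔭' h𝔭' he' hf' x) := by
    intro x
    have e1 : ringClassFieldToPadicComplex (p := p) ι' w₀.embedding 1
        (algebraMap K (ringClassField K w₀.embedding 1) x) =
      algebraMap (PadicAlgCl p) ℂ_[p]
        (ι'.symm ((algebraMap K (ringClassField K w₀.embedding 1) x : ringClassField K w₀.embedding 1) : ℂ)) :=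
      rfl
    rw [e1, coe_algebraMap_ringClassField,
      KYRead.LogDescent.symm_apply_eq_embAt_of_forall_mem_iff_norm_lt_one h2f h𝔮 he𝔮 hf𝔮 h𝔭' he' hf' hne ι'
        w₀.embedding hind x,
      ← IsScalarTower.algebraMap_apply]
  -- the weighted logarithm sum is the logarithm of the twisted trace
  obtain ⟨-, hlog⟩ := heegnerCharLogSum_eq_padicLog_map_sum p ι' w₀.embedding 1 W₁ ν s hν y
  -- `‖Δ_E‖ = ‖Δ_{W₁}‖` in `ℂ_p`
  have hΔn : ‖((C₂ • (D • W₁).quadraticTwist (((-1 : ℤ) ^ (q / 2) * q : ℤ) : ℚ)).baseChange ℂ_[p]).Δ‖ =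
      ‖(W₁.baseChange ℂ_[p]).Δ‖ :=
    (norm_Δ_baseChange_eq_of_twist p (algebraMap ℚ_[p] ℂ_[p] : ℚ_[p] →+* ℂ_[p]) heC hp2 hpd hd₁0
      (C₂ • (D • W₁).quadraticTwist (((-1 : ℤ) ^ (q / 2) * q : ℤ) : ℚ)) W₁ C hC).symm
  -- the twist descent of the logarithm
  obtain ⟨hlam, hdesc⟩ := padicLog_map_eq_mul_logOmega_of_descent_of_norm_Δ_eq p W₁ D C₂
    (((-1 : ℤ) ^ (q / 2) * q : ℤ) : ℚ) hθ2' hθ0 _ Q (by convert hQ) (embAt K p 𝔭' h𝔭' he' hf')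
    (algebraMap ℚ_[p] ℂ_[p] : ℚ_[p] →+* ℂ_[p]) heC (ringClassFieldToPadicComplex (p := p) ι' w₀.embedding 1) hj hΔn
  -- (`Eq.trans` unifies the two spellings of the `ℂ_p`-instances up to definitional equality; `rw` would not)
  exact ⟨_, hlam, hlog.trans hdesc⟩

end Transport

end Summit.BirchSwinnertonDyer.BirchSwinnertonDyer.Theorems.TwistedWanRoad

end
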